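import Summits.Ventures.PercRepro.MSTightNoMemberContains

/-!
# No member contains `W` ((NW)(iii) of Addendum 38, at the instance level)

Dossier proofs/MINE1-theoremS.md, Addendum 38 §2 (NW)(iii), and proofs/MINE1-RSTARM-PROOF.md §3 (NW).
Write `W = {a ∈ u : u.erase a ∈ U}` (the vertices `a` of `u` with `ū ∪ {a} ∈ L'`, i.e. the complement
of `I = ⋂ (U ∩ 2^u)`). In a residue instance no member of `T` contains `W`:

* a member `y ⊆ u` containing `W` is `u` (for `a ∈ u \ y`, `u.erase a ⊇ y` is in the up-set `U`, so
  `a ∈ W ⊆ y`), and `u` is not a face;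
* a member `y ⊄ u` has an outside vertex `m ∈ y`, a non-tightening direction with
  `ρ_m = u ∩ R*(K_m) ∈ T` ((F7), MSTightAdjoin.lean); every `a ∈ u \ ρ_m` has `u.erase a ⊇ ρ_m`, so
  `u \ ρ_m ⊆ W`, while `y ⊉ u \ ρ_m` by `not_sdiff_inter_Rstar_subset_of_mem`
  (MSTightNoMemberContains.lean).

The data at the outside vertices (non-tightening, nonempty partner family, `ρ_m ∈ T`) are taken as
hypotheses (`hout`); in the instance they are (F5)/(F7).
-/

namespace PercRepro.MSTight

open Finset

variable {α : Type*} [DecidableEq α] [Fintype α]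

/-- **(NW)(iii).** No member of `T` contains `W = {a ∈ u : u.erase a ∈ U}`. -/
theorem not_filter_erase_mem_subset {U T : Finset (Finset α)} {u : Finset α}
    (hU : ∀ x ∈ U, ∀ x', x ⊆ x' → x' ∈ U) (hTU : T ⊆ U) (huC : ∀ y ∈ T, ¬ u ⊆ y)
    (hout : ∀ y ∈ T, ¬ y ⊆ u → ∃ m ∈ y, m ∉ u ∧
      (diffsX m T ∩ diffsY m T).card = (partner m T).card ∧ (partner m T).Nonempty ∧
      u ∩ Rstar (partner m T) ∈ T)
    {y : Finset α} (hy : y ∈ T) : ¬ (u.filter fun a => u.erase a ∈ U) ⊆ y := by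
  intro hW
  by_cases hyu : y ⊆ u
  · -- a member inside `u` containing `W` is `u`
    apply huC y hy
    intro a hau
    by_contra hay
    have h1 : u.erase a ∈ U := by
      refine hU y (hTU hy) _ ?_
      intro b hb
      rw [mem_erase]
      exact ⟨fun hba => hay (hba ▸ hb), hyu hb⟩
    exact hay (hW (mem_filter.2 ⟨hau, h1⟩))
  · obtain ⟨m, hmy, hmu, hε, hK, hρ⟩ := hout y hy hyu
    -- `u \ ρ_m ⊆ W ⊆ y`, against `not_sdiff_inter_Rstar_subset_of_mem`
    refine not_sdiff_inter_Rstar_subset_of_mem hε hK huC hy hmy ?_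
    intro a ha
    obtain ⟨hau, haρ⟩ := mem_sdiff.1 ha
    refine hW (mem_filter.2 ⟨hau, ?_⟩)
    refine hU _ (hTU hρ) _ ?_
    intro b hb
    rw [mem_erase]
    exact ⟨fun hba => haρ (hba ▸ hb), (mem_inter.1 hb).1⟩

end PercRepro.MSTight
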